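import Summits.QuantumFields.YangMills.Theorems.UnitScaleTiltFluctuationComparisonRegPrGlobalSlackLocalToGlobal

/-!
# `UnitScaleTiltFluctuationComparisonRegPrGlobalSlackLocalToGlobalPure` — THE PURE-FIRST ENTRY of STUB 3⁗ (crux `FluctuationComparisonRegPrL`, stmt-QuantumFields-19935;
# OWNER RULING ym3-torus-plan g20-№11 ADDENDUM 3, line of record)

Seat ym3-torus-p2 g14 (sibling of the verbatim port `…GlobalSlackLocalToGlobal` of ym-cruxidea-19201-1 g11's producer).  ADDENDUM 3 (FINDING N8 of ym-cruxidea-19201-2 g11):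
for print's polynomial activities ((43) p.266: degree 2..6, flat kernels, no rest inside the term) the per-polymer two-run row is the socket's SLACK-FREE row
`T3AlphaInputsACTwoRunLevel.PolymerCauchyMinAtT D PT b₀ p₀ κ₁ a C` (K1a flat-kernel Cauchy + sizes + configuration Cauchy; `polymerCauchyMinAtT_of_charts` /
`polymerCauchyMinAtT_of_polySplit` in the lanes' sketches), and the slack `θ(n)^σ` of 3⁗ is admissible but idle.  This file is the by-name bridge from that pure row to
3⁗'s tail: `polymerSlack_of_pure` (pure ⟹ slack row, any `σ`; = ideator 2 g11's `Ideate2SlackOrder.slack_of_pure`, verbatim body), `globalSupRateTSlack_of_polymerPure`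
(⟹ `GlobalSlack.GlobalSupRateTSlack` with the producer's `K`-uniform constant), `globalTwoRunSlackTail_of_polymerPure` (⟹ `∃ σ₀ C₀, 7 ≤ σ₀ ∧ 0 ≤ C₀ ∧ …`, `σ₀ = 7`).
Bookkeeping only; nothing of [Balaban1985UV3] / [King1986] is asserted.

References: C. King, CMP 102 (1986) 649–677 [King1986] (Thm 3.4 (3.9) p.656, (3.12)–(3.13) p.657); T. Bałaban, CMP 102 (1985) 255–275 [Balaban1985UV3]
((43)–(46) pp.266–267, (57) p.270).
-/

set_option autoImplicit false

noncomputable section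

open scoped BigOperators
open Literature.MathematicalPhysics.QuantumFieldTheory.Balaban1983to89
open Literature.MathematicalPhysics.QuantumFieldTheory.Balaban1983to89.T3ContinuumYM3Torus
open Literature.MathematicalPhysics.QuantumFieldTheory.Balaban1983to89.T3UnitScaleTilt
open Literature.MathematicalPhysics.QuantumFieldTheory.Balaban1983to89.T3LevelShift
open Literature.MathematicalPhysics.QuantumFieldTheory.Balaban1983to89.T3AlphaInputsAC
open Literature.MathematicalPhysics.QuantumFieldTheory.Balaban1983to89.T3AlphaPolymerSocket
open Literature.MathematicalPhysics.QuantumFieldTheory.Balaban1983to89.T3AlphaInputsACTwoRun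
open Literature.MathematicalPhysics.QuantumFieldTheory.Balaban1983to89.T3AlphaInputsACTwoRunLevel
open Literature.MathematicalPhysics.QuantumFieldTheory.Balaban1983to89.T3Thresholds
open Summit.QuantumFields.YangMills.Theorems.GlobalSlack (GlobalSupRateTSlack)
open Summit.QuantumFields.YangMills.Theorems.GlobalSlackLocalToGlobal

namespace Summit.QuantumFields.YangMills.Theorems.GlobalSlackLocalToGlobalPure

variable {F : T3Family} {γ : ℝ}

/-! ## The socket's slack-free per-polymer row ⟹ the slack row ⟹ the global row ⟹ 3⁗'s tail -/

/-- **THE SOCKET'S PURE PER-POLYMER ROW IMPLIES THE SLACK ROW** (any `σ`; `0 ≤ C`, `θ ≥ 0`): `T3AlphaInputsACTwoRunLevel.PolymerCauchyMinAtT D PT b₀ p₀ κ₁ a C →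
PolymerCauchyMinAtTSlack D PT b₀ p₀ κ₁ a σ C` (= ideator 2 g11's `Ideate2SlackOrder.slack_of_pure`, verbatim body). [cite: King1986, Thm 3.4 (3.9) p.656] -/
theorem polymerSlack_of_pure {D : AlphaDataT3 F γ} {PT : TermFn F} {b₀ p₀ κ₁ a C : ℝ} (σ : ℕ) (hC : 0 ≤ C)
    (hθ : ∀ n, 0 ≤ θBal F.L γ b₀ p₀ n) (h : PolymerCauchyMinAtT D PT b₀ p₀ κ₁ a C) :
    PolymerCauchyMinAtTSlack D PT b₀ p₀ κ₁ a σ C := by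
  obtain ⟨c, hc⟩ := h
  refine ⟨c, ?_⟩
  intro K n hn j hj V hV Y hY
  refine (hc K n hn j hj V hV Y hY).trans ?_
  have hP : 0 ≤ C * Real.exp (-κ₁ * D.treeLen K (1 + j) Y) * (((F.L : ℝ) ^ (K - n - 1 - j))⁻¹) ^ 4 :=
    mul_nonneg (mul_nonneg hC (Real.exp_pos _).le) (by positivity)
  have hσ : 0 ≤ θBal F.L γ b₀ p₀ n ^ σ := pow_nonneg (hθ n) σ
  have hmain : C * Real.exp (-κ₁ * D.treeLen K (1 + j) Y) * θBal F.L γ b₀ p₀ n ^ 2 *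
        (((F.L : ℝ) ^ (K - n - 1 - j))⁻¹) ^ 4 * (((F.L : ℝ) ^ (1 + j))⁻¹) ^ a =
      C * Real.exp (-κ₁ * D.treeLen K (1 + j) Y) * (((F.L : ℝ) ^ (K - n - 1 - j))⁻¹) ^ 4 *
        (θBal F.L γ b₀ p₀ n ^ 2 * (((F.L : ℝ) ^ (1 + j))⁻¹) ^ a) := by ring
  rw [hmain, mul_add]
  exact le_add_of_nonneg_right (mul_nonneg hP hσ)

/-- **THE GLOBAL SLACK ROW FROM THE SOCKET'S PURE PER-POLYMER ROW** (PROVED; any `σ`): the five geometric / size rows and `PolymerCauchyMinAtT D PT b₀ p₀ κ₁ a C`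
(`0 < a < 1`, `0 ≤ C`) give `GlobalSupRateTSlack D b₀ p₀ a σ (max C′ 0 · (C_T + C/(1 − L^{a−1}) + C/(1 − L⁻¹)))` — the by-name target for a lane that proves the
pure row (e.g. `polymerCauchyMinAtT_of_charts` / `polymerCauchyMinAtT_of_polySplit`). [cite: King1986, Thm 3.4 (3.9) p.656 and (3.12)-(3.13) p.657; Balaban1985UV3, (43)-(46) pp.266-267] -/
theorem globalSupRateTSlack_of_polymerPure {D : AlphaDataT3 F γ} {PT : TermFn F} {b₀ p₀ κ₁ a C C_T C' : ℝ} (σ : ℕ)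
    (hγ : 0 < γ) (hγ1 : γ ≤ 1) (hγe : Real.sqrt γ ≤ Real.exp (1 - p₀)) (hb : 0 < b₀) (hp : 0 ≤ p₀)
    (ha : 0 < a) (ha1 : a < 1) (hC : 0 ≤ C) (hCT : 0 ≤ C_T)
    (hdec : PintDecompTrivT D PT) (hLC : LocCover D κ₁ C') (hBV : LocBlockVolume D) (hLM : LocMatched D)
    (hTS : TermSizeTrivT D PT b₀ p₀ C_T κ₁) (hPC : PolymerCauchyMinAtT D PT b₀ p₀ κ₁ a C) :
    GlobalSupRateTSlack D b₀ p₀ a σ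
      (max C' 0 * (C_T + C / (1 - (F.L : ℝ) ^ (a - 1)) + C / (1 - (F.L : ℝ)⁻¹))) := by
  have hLn : 1 ≤ F.L := F.hL.2.le
  have hθ : ∀ i, 0 ≤ θBal F.L γ b₀ p₀ i := fun i => (T3MinimiserStabilityReduction.θBal_pos hLn hγ hγ1 hb p₀ i).le
  exact globalSupRateTSlack_of_polymerSlack hγ hγ1 hγe hb hp ha ha1 hC hCT hdec hLC hBV hLM hTS (polymerSlack_of_pure σ hC hθ hPC)

/-- **THE TAIL OF STUB 3⁗ FROM THE SOCKET'S PURE PER-POLYMER ROW** (PROVED; `σ₀ = 7`): `∃ σ₀ C₀, 7 ≤ σ₀ ∧ 0 ≤ C₀ ∧ GlobalSupRateTSlack D b₀ p₀ a σ₀ C₀`.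
[cite: King1986, Thm 3.4 (3.9) p.656; Balaban1985UV3, (43)-(46) pp.266-267 and (57) p.270] -/
theorem globalTwoRunSlackTail_of_polymerPure {D : AlphaDataT3 F γ} {PT : TermFn F} {b₀ p₀ κ₁ a C C_T C' : ℝ}
    (hγ : 0 < γ) (hγ1 : γ ≤ 1) (hγe : Real.sqrt γ ≤ Real.exp (1 - p₀)) (hb : 0 < b₀) (hp : 0 ≤ p₀)
    (ha : 0 < a) (ha1 : a < 1) (hC : 0 ≤ C) (hCT : 0 ≤ C_T)
    (hdec : PintDecompTrivT D PT) (hLC : LocCover D κ₁ C') (hBV : LocBlockVolume D) (hLM : LocMatched D)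
    (hTS : TermSizeTrivT D PT b₀ p₀ C_T κ₁) (hPC : PolymerCauchyMinAtT D PT b₀ p₀ κ₁ a C) :
    ∃ (σ₀ : ℕ) (C₀ : ℝ), 7 ≤ σ₀ ∧ 0 ≤ C₀ ∧ GlobalSupRateTSlack D b₀ p₀ a σ₀ C₀ := by
  have hLn : 1 ≤ F.L := F.hL.2.le
  have hθ : ∀ i, 0 ≤ θBal F.L γ b₀ p₀ i := fun i => (T3MinimiserStabilityReduction.θBal_pos hLn hγ hγ1 hb p₀ i).le
  exact globalTwoRunSlackTail_of_polymerSlack hγ hγ1 hγe hb hp ha ha1 hC hCT le_rfl hdec hLC hBV hLM hTS (polymerSlack_of_pure 7 hC hθ hPC)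

end Summit.QuantumFields.YangMills.Theorems.GlobalSlackLocalToGlobalPure

end
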